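/-
Copyright (c) 2026. All rights reserved.
Released under Apache 2.0 license as described in the file LICENSE.
Authors: abc-iut cell, wave-2 prover seat abc-iut-L5-t15.
-/
import Mathlib.RingTheory.Finiteness.Quotient
import Literature.IUT.LogVolume.RelativeIntegerRing
import Literature.NumberTheory.NumberFields.DifferentTameRamification
import Literature.NumberTheory.NumberFields.LenstraDifferentBound
import HarnessLib

/-!
# [IUTchIV] Proposition 1.3 (Estimates of Differents) — proofs

Mochizuki, *Inter-universal Teichmüller theory IV*, RIMS manuscript (Apr. 2020), §1,
Proposition 1.3, kurims pp. 11–12 (typed statements `Prop13i`, `Prop13ii` of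
`DifferentEstimates.lean`). PROOF-ONLY companion (theorems only, no definition, no named fact):
`prop13i_holds : Prop13i p k₀ K` and `prop13ii_holds : Prop13ii p k₀ K k₁`.

## Route (classical; every deep input is a tree theorem)

Write `𝒪₀ = 𝒪_{k₀} ⊆ 𝒪 = 𝒪_K` (the isometric embedding `k₀ → K` restricts to the unit balls),
`e₀ ∣ e = e_K`, `e' = e/e₀` (`relRamificationIdx`), `𝔪₀ 𝒪 = 𝔪^{e'}` (`map_maximalIdeal_relInt`).

* Transitivity of the different (Mathlib `differentIdeal_eq_differentIdeal_mul_differentIdeal` for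
  `ℤ_p ⊆ 𝒪₀ ⊆ 𝒪`): `𝔇(𝒪/ℤ_p) = 𝔇(𝒪/𝒪₀) · 𝔇(𝒪₀/ℤ_p)𝒪`, whence `d_K = d₀ + ord(h)` for a generator
  `h` of `𝔇(𝒪/𝒪₀)` (`exists_differentIdeal_relInt_eq_span`; `ord = -log_p ‖·‖`).
* (i) `≥`: `𝔪^{e'-1} ∣ 𝔇(𝒪/𝒪₀)` (Mathlib `pow_sub_one_dvd_differentIdeal`), i.e.
  `ord(h) ≥ (e'-1)/e`.
* (i) tame `=`: `𝔪^{e'} ∣ 𝔇(𝒪/𝒪₀) ↔ p ∣ e'` (tree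
  `Literature.NumberTheory.NumberFields.pow_dvd_differentIdeal_iff_natCast_ramificationIdx_mem`,
  Serre, *Corps locaux* III §6 Prop. 13), so `ord(h) = (e'-1)/e` when `p ∤ e'`.
* (ii): Lenstra's bound (tree
  `Literature.NumberTheory.NumberFields.not_span_dvd_differentIdeal_of_charZero`, Javanpeykar 2014
  Prop. 4.1.1): `(n ϖ₁)𝒪 ∤ 𝔇(𝒪/𝒪₁)` for `n = [K : k₁]`, i.e. `ord(h₁) < v_p(n) + 1/e₁`; with the
  tame equality for `k₁/k₀` (`d₁ = d₀ + (e₁/e₀ - 1)/e₁`) this gives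
  `d_K < d₀ + 1/e₀ + v_p([K : k₁]) ≤ d₀ + n_i + 1/e₀`.

NOTE (read with the referee): on this route the printed hypothesis "`k_i` is a finite Galois
extension of `k_1`" of (ii) is not used — `Prop13ii` is proved exactly as typed, the Galois
hypothesis being idle; the printed proof (induction on `n_i`, Kummer generators, enlarging `k_1`) is
replaced by Lenstra's trace argument. Nothing here is disputed mathematics; the [IUTchIV] locators
record the cell's typing.

## References

* S. Mochizuki, *Inter-universal Teichmüller theory IV*, §1 Prop. 1.3
  [claim: Mochizuki2012, status: disputed].
* J.-P. Serre, *Local Fields*, GTM 67, Ch. III §6 Prop. 13 and Remark.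
* A. Javanpeykar, *Polynomial bounds for Arakelov invariants of Belyi curves*, ANT 8 (2014),
  Prop. 4.1.1.
-/

noncomputable section

open Metric Set IsLocalRing Module
open scoped NormedField

namespace Literature.IUT.LogVolume

open Literature.NumberTheory.GaloisRepresentations.Ultrametric (exists_norm_eq_pow_of_norm_le_one
  finite_residueField)
open Literature.NumberTheory.NumberFields (isSeparable_fractionRing_of_isSeparable
  pow_dvd_differentIdeal_iff_natCast_ramificationIdx_mem not_span_dvd_differentIdeal_of_charZero)

variable (p : ℕ) [Fact p.Prime]
variable (k₀ : Type*) [NontriviallyNormedField k₀] [inst₀ : NormedAlgebra ℚ_[p] k₀]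
  [IsUltrametricDist k₀] [ProperSpace k₀]
variable (K : Type*) [NontriviallyNormedField K] [instK : NormedAlgebra ℚ_[p] K]
  [IsUltrametricDist K]
  [ProperSpace K] [NormedAlgebra k₀ K]

section RelInt

/-! ## The relative different `𝔇(𝒪/𝒪₀)` and `d_K - d₀`

The algebra `𝒪₀ → 𝒪` (with `IsScalarTower 𝒪₀ 𝒪 K` and torsion-freeness) is abc-iut-S1's scoped
instance of `RelativeRamification.lean`. -/

/-- **Transitivity of the different** along `ℤ_p ⊆ 𝒪₀ ⊆ 𝒪`:
`𝔇(𝒪/ℤ_p) = 𝔇(𝒪/𝒪₀) · 𝔇(𝒪₀/ℤ_p) 𝒪`. [cite: SerreLocalFields1979, Ch. III §4 Prop. 8] -/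
theorem different_eq_mul_map_different
    [IsScalarTower ℚ_[p] k₀ K] :
    different p K = differentIdeal (Valued.integer k₀) (Valued.integer K) *
      (different p k₀).map (algebraMap (Valued.integer k₀) (Valued.integer K)) := by
  haveI := isScalarTower_padicInt_integer p k₀ K
  haveI := moduleFinite_relInt p k₀ K
  haveI := isSeparable_fractionRing p K
  rw [different_eq, different_eq]
  exact differentIdeal_eq_differentIdeal_mul_differentIdeal ℤ_[p] (Valued.integer k₀)
    (Valued.integer K)

/-- The relative different `𝔇(𝒪/𝒪₀)` is principal with a nonzero generator `h`, and
**`d_K = d₀ + ord(h)`** (`ord(h) = -log_p ‖h‖`). [claim: Mochizuki2012, status: disputed] -/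
theorem exists_differentIdeal_relInt_eq_span
    [IsScalarTower ℚ_[p] k₀ K] :
    ∃ h : Valued.integer K, differentIdeal (Valued.integer k₀) (Valued.integer K) = Ideal.span {h} ∧
      (h : K) ≠ 0 ∧ differentOrd p K = differentOrd p k₀ + -Real.logb p ‖(h : K)‖ := by
  obtain ⟨h, hh⟩ : ∃ h : Valued.integer K,
      differentIdeal (Valued.integer k₀) (Valued.integer K) = Ideal.span {h} :=
    ⟨_, (IsPrincipalIdealRing.principal _).span_singleton_generator.symm⟩
  obtain ⟨g₀, hg₀⟩ := exists_different_eq_span p k₀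
  have hg₀0 : (g₀ : k₀) ≠ 0 := fun h' ↦ generator_ne_zero p k₀ hg₀ (Subtype.ext h')
  have hg : different p K =
      Ideal.span {h * algebraMap (Valued.integer k₀) (Valued.integer K) g₀} := by
    rw [different_eq_mul_map_different p k₀ K, hh, hg₀, Ideal.map_span, Set.image_singleton,
      Ideal.span_singleton_mul_span_singleton]
  have hgen0 := generator_ne_zero p K hg
  have hh0 : (h : K) ≠ 0 := by
    intro h'
    apply hgen0
    rw [show h = 0 from Subtype.ext h', zero_mul]
  refine ⟨h, hh, hh0, ?_⟩
  rw [differentOrd_eq_of_span p K hg, differentOrd_eq_of_span p k₀ hg₀]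
  push_cast
  rw [norm_mul, norm_algebraMap_relInt, Real.logb_mul (norm_ne_zero_iff.mpr hh0)
    (norm_ne_zero_iff.mpr hg₀0)]
  ring

/-- **(i), lower bound**: `𝔪^{e'-1} ∣ 𝔇(𝒪/𝒪₀)` (Mathlib's `pow_sub_one_dvd_differentIdeal`).
[cite: SerreLocalFields1979, Ch. III §6 Prop. 13] -/
theorem maximalIdeal_pow_sub_one_dvd_differentIdeal_relInt
    [IsScalarTower ℚ_[p] k₀ K] :
    maximalIdeal (Valued.integer K) ^ (relRamificationIdx p k₀ K - 1) ∣
      differentIdeal (Valued.integer k₀) (Valued.integer K) := by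
  haveI := moduleFinite_relInt p k₀ K
  haveI := isSeparable_rel p k₀ K
  letI := FractionRing.liftAlgebra (Valued.integer k₀) (FractionRing (Valued.integer K))
  haveI : Algebra.IsSeparable (FractionRing (Valued.integer k₀))
      (FractionRing (Valued.integer K)) :=
    isSeparable_fractionRing_of_isSeparable (Valued.integer k₀) k₀ K (Valued.integer K)
  exact pow_sub_one_dvd_differentIdeal (Valued.integer k₀) (p := maximalIdeal (Valued.integer k₀))
    (maximalIdeal (Valued.integer K)) _ (IsDiscreteValuationRing.not_a_field _)
    (by rw [map_maximalIdeal_relInt p k₀ K])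

/-- **(i), tame case**: if `p ∤ e'` then `𝔪^{e'} ∤ 𝔇(𝒪/𝒪₀)` (Serre, III §6 Prop. 13, from the
tree's `pow_dvd_differentIdeal_iff_natCast_ramificationIdx_mem`).
[cite: SerreLocalFields1979, Ch. III §6 Prop. 13] -/
theorem not_maximalIdeal_pow_dvd_differentIdeal_relInt
    [IsScalarTower ℚ_[p] k₀ K] (htame : ¬ p ∣ relRamificationIdx p k₀ K) :
    ¬ maximalIdeal (Valued.integer K) ^ relRamificationIdx p k₀ K ∣
      differentIdeal (Valued.integer k₀) (Valued.integer K) := by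
  haveI := moduleFinite_relInt p k₀ K
  haveI := isSeparable_rel p k₀ K
  haveI := liesOver_maximalIdeal_relInt k₀ K
  haveI := liesOver_maximalIdeal_pow_relInt p k₀ K
  letI := Ideal.Quotient.field (maximalIdeal (Valued.integer k₀))
  letI := Ideal.Quotient.field (maximalIdeal (Valued.integer K))
  haveI : Finite (Valued.integer k₀ ⧸ maximalIdeal (Valued.integer k₀)) :=
    (finite_residueField : Finite (ResidueField (Valued.integer k₀)))
  haveI : Algebra.IsAlgebraic (Valued.integer k₀ ⧸ maximalIdeal (Valued.integer k₀))
      (Valued.integer K ⧸ maximalIdeal (Valued.integer K)) :=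
    Algebra.IsAlgebraic.of_finite _ _
  rw [pow_dvd_differentIdeal_iff_natCast_ramificationIdx_mem (Valued.integer k₀) k₀ K
    (Valued.integer K) (IsDiscreteValuationRing.not_a_field _) (maximalIdeal (Valued.integer K))
    (relRamificationIdx_pos p k₀ K).ne' (I := ⊤)
    (by rw [Ideal.mul_top, map_maximalIdeal_relInt p k₀ K])
    (by rw [sup_top_eq]), natCast_mem_maximalIdeal_iff p k₀]
  exact htame

/-- **(ii), Lenstra's bound**: for a generator `h` of `𝔇(𝒪/𝒪₀)` and a uniformizer `ϖ₀` of `k₀`,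
`‖[K : k₀]‖ · ‖ϖ₀‖ < ‖h‖`, i.e. `(n ϖ₀) 𝒪 ∤ 𝔇(𝒪/𝒪₀)` (Javanpeykar 2014, Prop. 4.1.1, from the
tree's `not_span_dvd_differentIdeal_of_charZero`). [cite: Javanpeykar2014, Prop. 4.1.1] -/
theorem norm_finrank_mul_norm_lt_norm_generator
    [IsScalarTower ℚ_[p] k₀ K] {h : Valued.integer K}
    (hh : differentIdeal (Valued.integer k₀) (Valued.integer K) = Ideal.span {h})
    {ϖ₀ : Valued.integer k₀} (h₀ : Irreducible ϖ₀) :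
    ‖((Module.finrank k₀ K : ℕ) : k₀)‖ * ‖(ϖ₀ : k₀)‖ < ‖(h : K)‖ := by
  haveI := moduleFinite_relInt p k₀ K
  haveI := isSeparable_rel p k₀ K
  haveI := finiteDimensional_rel p k₀ K
  haveI := charZero_base p k₀
  haveI := charZero_integer k₀
  have key := not_span_dvd_differentIdeal_of_charZero (Valued.integer k₀) k₀ K (Valued.integer K)
    (x := ϖ₀) h₀.not_isUnit
  rw [hh, Ideal.span_singleton_dvd_span_singleton_iff_dvd, dvd_iff_norm_le, not_le,
    norm_algebraMap_relInt] at key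
  push_cast at key
  rwa [norm_mul] at key

end RelInt

/-! ## Proposition 1.3 -/

/-- The data used in both parts: a generator `h` of `𝔇(𝒪/𝒪₀)` with `‖h‖ = ‖ϖ‖^j`, `d_K = d₀ + j/e`, `e' - 1 ≤ j`, and `j = e' - 1` in the tame case.
[claim: Mochizuki2012, status: disputed] -/
theorem exists_generator_exponent [IsScalarTower ℚ_[p] k₀ K]
    {ϖ : Valued.integer K} (hϖ : Irreducible ϖ) :
    ∃ h : Valued.integer K, ∃ j : ℕ,
      differentIdeal (Valued.integer k₀) (Valued.integer K) = Ideal.span {h} ∧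
      ‖(h : K)‖ = ‖(ϖ : K)‖ ^ j ∧
      differentOrd p K = differentOrd p k₀ + (j : ℝ) / absRamificationIdx p K ∧
      relRamificationIdx p k₀ K - 1 ≤ j ∧
      (IsTamelyRamified p k₀ K → j = relRamificationIdx p k₀ K - 1) := by
  obtain ⟨h, hh, hh0, hd⟩ := exists_differentIdeal_relInt_eq_span p k₀ K
  obtain ⟨j, hj⟩ := exists_norm_eq_pow_of_norm_le_one hϖ (h : K) hh0 (Valued.integer.norm_le_one h)
  have hϖ1 : ‖(ϖ : K)‖ < 1 := Valued.integer.norm_irreducible_lt_one hϖ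
  have hϖ0 : 0 < ‖(ϖ : K)‖ := Valued.integer.norm_irreducible_pos hϖ
  have hlow := maximalIdeal_pow_sub_one_dvd_differentIdeal_relInt p k₀ K
  rw [hh, maximalIdeal_pow_dvd_span_singleton_iff K hϖ, hj,
    pow_le_pow_iff_right_of_lt_one₀ hϖ0 hϖ1] at hlow
  refine ⟨h, j, hh, hj, ?_, hlow, fun htame ↦ ?_⟩
  · rw [hd, neg_logb_norm_eq_div p K hϖ hj]
  · have hnot := not_maximalIdeal_pow_dvd_differentIdeal_relInt p k₀ K htame
    rw [hh, maximalIdeal_pow_dvd_span_singleton_iff K hϖ, hj,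
      pow_le_pow_iff_right_of_lt_one₀ hϖ0 hϖ1, not_le] at hnot
    omega

/-- **[IUTchIV] Proposition 1.3 (i)** (kurims pp. 11–12), proved: for an isometric `ℚ_p`-embedding
`k₀ → K`, `d_K ≥ d₀ + (e' - 1)/e_K`, with equality when `K/k₀` is tamely ramified.
[claim: Mochizuki2012, status: disputed] -/
theorem prop13i_holds : Prop13i p k₀ K := by
  intro hST
  obtain ⟨ϖ, hϖ⟩ := IsDiscreteValuationRing.exists_irreducible (Valued.integer K)
  obtain ⟨h, j, -, -, hd, hlow, htame⟩ := exists_generator_exponent p k₀ K hϖ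
  have he := absRamificationIdx_pos p K
  have he' := relRamificationIdx_pos p k₀ K
  have hcast : ((relRamificationIdx p k₀ K : ℝ) - 1) =
      ((relRamificationIdx p k₀ K - 1 : ℕ) : ℝ) := by
    rw [Nat.cast_sub he', Nat.cast_one]
  have hepos : (0 : ℝ) < absRamificationIdx p K := by exact_mod_cast he
  refine ⟨?_, fun ht ↦ ?_⟩
  · rw [hd, hcast]
    have : ((relRamificationIdx p k₀ K - 1 : ℕ) : ℝ) ≤ j := by exact_mod_cast hlow
    gcongr
  · rw [hd, hcast, htame ht]

variable (k₁ : Type*) [NontriviallyNormedField k₁] [inst₁ : NormedAlgebra ℚ_[p] k₁]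
  [IsUltrametricDist k₁] [NormedAlgebra k₀ k₁] [NormedAlgebra k₁ K]

/-- **[IUTchIV] Proposition 1.3 (ii)** (kurims p. 12), proved: for `ℚ_p ⊆ k₀ ⊆ k₁ ⊆ K` with `k₁/k₀`
tamely ramified, `d_K ≤ d₀ + n + 1/e₀` where `n = v_p([K : k₀])` (indeed
`d_K < d₀ + 1/e₀ + v_p([K : k₁])`). The hypotheses "`K/k₁` finite Galois" of the typed statement are
not used. [claim: Mochizuki2012, status: disputed] -/
theorem prop13ii_holds [ProperSpace k₁] : Prop13ii p k₀ K k₁ := by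
  intro hST hST₀₁ hST₁ hST' _hfd _hgal htame
  -- `d₁ = d₀ + (e(k₁/k₀) - 1)/e₁` (tame equality of (i))
  obtain ⟨ϖ₁, hϖ₁⟩ := IsDiscreteValuationRing.exists_irreducible (Valued.integer k₁)
  obtain ⟨-, j₁, -, -, hd₁, -, htame₁⟩ := exists_generator_exponent p k₀ k₁ hϖ₁
  have hj₁ := htame₁ htame
  -- `d_K = d₁ + j/e` with Lenstra's bound on `j`
  obtain ⟨ϖ, hϖ⟩ := IsDiscreteValuationRing.exists_irreducible (Valued.integer K)
  obtain ⟨h, j, hh, hj, hd, -, -⟩ := exists_generator_exponent p k₁ K hϖ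
  have hlen := norm_finrank_mul_norm_lt_norm_generator p k₁ K hh hϖ₁
  -- numerics
  have hp1 : (1 : ℝ) < p := by exact_mod_cast (Fact.out : p.Prime).one_lt
  have hp0 : (0 : ℝ) < p := by positivity
  haveI := finiteDimensional_rel p k₁ K
  haveI := finiteDimensional_rel p k₀ k₁
  have hn0 : Module.finrank k₁ K ≠ 0 := (Module.finrank_pos (R := k₁) (M := K)).ne'
  have hn0' : Module.finrank k₀ k₁ ≠ 0 := (Module.finrank_pos (R := k₀) (M := k₁)).ne'
  have he₀ := absRamificationIdx_pos p k₀
  have he₁ := absRamificationIdx_pos p k₁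
  have he := absRamificationIdx_pos p K
  have he₁' := relRamificationIdx_pos p k₀ k₁
  have hmul₁ := relRamificationIdx_mul p k₀ k₁
  -- Lenstra in exponents: `j/e < v_p([K:k₁]) + 1/e₁`
  have hlen' : (j : ℝ) / absRamificationIdx p K <
      padicValNat p (Module.finrank k₁ K) + 1 / (absRamificationIdx p k₁ : ℝ) := by
    rw [hj, norm_irreducible_pow_eq p K hϖ, norm_natCast_eq_rpow_neg p k₁ hn0,
      norm_irreducible_eq p k₁ hϖ₁, ← Real.rpow_add hp0, Real.rpow_lt_rpow_left_iff hp1] at hlen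
    linarith
  -- `v_p([K:k₁]) ≤ v_p([K:k₀]) = n`
  have hv : padicValNat p (Module.finrank k₁ K) ≤ wildExponent p k₀ K := by
    rw [wildExponent, ← Module.finrank_mul_finrank k₀ k₁ K, padicValNat.mul hn0' hn0]
    exact Nat.le_add_left _ _
  have hv' : (padicValNat p (Module.finrank k₁ K) : ℝ) ≤ wildExponent p k₀ K := by exact_mod_cast hv
  -- `(e(k₁/k₀) - 1)/e₁ + 1/e₁ = 1/e₀`
  have he₁pos : (0 : ℝ) < absRamificationIdx p k₁ := by exact_mod_cast he₁
  have hrel : ((relRamificationIdx p k₀ k₁ - 1 : ℕ) : ℝ) / absRamificationIdx p k₁ +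
      1 / (absRamificationIdx p k₁ : ℝ) = 1 / (absRamificationIdx p k₀ : ℝ) := by
    have hmul₁' : (relRamificationIdx p k₀ k₁ : ℝ) * absRamificationIdx p k₀ =
        absRamificationIdx p k₁ := by
      exact_mod_cast hmul₁
    have he₀' : (absRamificationIdx p k₀ : ℝ) ≠ 0 := by exact_mod_cast he₀.ne'
    rw [Nat.cast_sub he₁', Nat.cast_one]
    field_simp
    linarith
  rw [hd, hd₁, hj₁]
  linarith

end Literature.IUT.LogVolume

end
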